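import Literature.AlgebraicGeometry.Resolution.RegularLocalRingsQuotient
import Literature.AlgebraicGeometry.Resolution.LogRegularScheme
import Mathlib.RingTheory.IntegralClosure.IntegrallyClosed
import Mathlib.RingTheory.Localization.FractionRing
import HarnessLib

/-!
# Monomial charts: four algebra lemmas behind Kato's condition (2.1) for the local models

Topic: `Literature/AlgebraicGeometry/Resolution`. Bookkeeping used when a chart
`ψ : P → 𝒪_{X,x}` of an fs monoid is compared with the monomials of a local model
(`LogChart.IsLogRegularLocal`, Kato 1994 Def. (2.1); the application is the endgame of the
crux `PicoverLocalModel`, local log-regular charts on the normalised `p`-cyclic cover):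

* `exists_isUnit_mul_of_pow_eq_unit_mul_pow` — in an integrally closed domain, `z^n = η w^n`
  with `η` a unit forces `z = γ w` with `γ` a unit (`z/w` is a root of `X^n - η`);
* `isUnit_algebraMap_iff_of_isIntegral` — for an integral extension `O → C` of local rings,
  `y ∈ O` becomes a unit in `C` iff it is a unit (the maximal ideal contracts to the maximal
  ideal);
* `prime_of_isRegularLocalRing_quotient` — if `R` and `R/(x_1, …, x_r)` are regular local with
  `dim R/(x) + r = dim R`, each `x_j` is a prime element (Matsumura Thm. 14.2: the `x_j` are
  independent in `𝔪/𝔪²`, then Thm. 14.3);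
* `LogChart.isLogRegularLocal_of_eq` — Kato's (2.1) from an identification of Kato's ideal,
  regularity of the quotient, and the two dimension counts.

Sources: [Kato1994] K. Kato, *Toric singularities*, Amer. J. Math. 116 (1994), Def. (2.1).
[Matsumura1987] H. Matsumura, *Commutative Ring Theory*, Thm. 14.2, Thm. 14.3.
-/

namespace Literature.AlgebraicGeometry.Resolution

open IsLocalRing Polynomial

universe u

/-- **Extracting roots up to units.** In an integrally closed domain, if `z ^ n = η * w ^ n`
with `η` a unit, `w ≠ 0` and `n ≠ 0`, then `z = γ * w` for a unit `γ` (with `γ ^ n = η`):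
`z / w` is a root of the monic `X ^ n - η`, hence lies in the ring. [folklore] -/
theorem exists_isUnit_mul_of_pow_eq_unit_mul_pow {N : Type*} [CommRing N] [IsDomain N]
    [IsIntegrallyClosed N] {n : ℕ} (hn : n ≠ 0) {η z w : N} (hη : IsUnit η) (hw : w ≠ 0)
    (h : z ^ n = η * w ^ n) : ∃ γ : N, IsUnit γ ∧ z = γ * w := by
  let K := FractionRing N
  have hinj := IsFractionRing.injective N K
  have hwK : algebraMap N K w ≠ 0 := (map_ne_zero_iff _ hinj).mpr hw
  set ρ : K := algebraMap N K z / algebraMap N K w with hρdef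
  have hρ : ρ ^ n = algebraMap N K η := by
    rw [hρdef, div_pow, ← map_pow, h, map_mul, map_pow, mul_div_assoc,
      div_self (pow_ne_zero _ hwK), mul_one]
  have hint : IsIntegral N ρ := by
    refine ⟨X ^ n - C η, monic_X_pow_sub_C η hn, ?_⟩
    rw [eval₂_sub, eval₂_X_pow, eval₂_C, hρ, sub_self]
  obtain ⟨γ, hγ⟩ := IsIntegrallyClosed.algebraMap_eq_of_integral hint
  refine ⟨γ, ?_, hinj ?_⟩
  · have hγn : γ ^ n = η := hinj (by rw [map_pow, hγ, hρ])
    exact (isUnit_pow_iff hn).mp (hγn ▸ hη)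
  · rw [map_mul, hγ, hρdef, div_mul_cancel₀ _ hwK]

/-- **Units along an integral extension of local rings.** If `C` is a local ring integral
over the local ring `O`, an element of `O` is a unit in `C` iff it is a unit in `O`: the
maximal ideal of `C` contracts to a maximal ideal of `O`, i.e. to `𝔪_O`. [folklore] -/
theorem isUnit_algebraMap_iff_of_isIntegral {O C : Type*} [CommRing O] [IsLocalRing O]
    [CommRing C] [IsLocalRing C] [Algebra O C] [Algebra.IsIntegral O C] (y : O) :
    IsUnit (algebraMap O C y) ↔ IsUnit y := by
  refine ⟨fun h => ?_, fun h => h.map _⟩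
  by_contra hy
  have hmax : ((maximalIdeal C).comap (algebraMap O C)).IsMaximal :=
    Ideal.isMaximal_comap_of_isIntegral_of_isMaximal _
  have heq : (maximalIdeal C).comap (algebraMap O C) = maximalIdeal O :=
    IsLocalRing.eq_maximalIdeal hmax
  have hmem : y ∈ (maximalIdeal C).comap (algebraMap O C) := by
    rw [heq]
    exact (IsLocalRing.mem_maximalIdeal _).mpr hy
  exact (IsLocalRing.mem_maximalIdeal _).mp (Ideal.mem_comap.mp hmem) h

/-- **Regular parameters are prime** (Matsumura Thm. 14.2 with Thm. 14.3): if `R` is a regular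
local ring, `x_1, …, x_r ∈ 𝔪`, and `R/(x_1, …, x_r)` is a regular local ring with
`dim R/(x) + r = dim R`, then the images of the `x_j` in `𝔪/𝔪²` are linearly independent; in
particular each `x_j ∉ 𝔪²` is a prime element. [cite: Matsumura1987, Thm. 14.2] -/
theorem prime_of_isRegularLocalRing_quotient {R : Type u} [CommRing R] [IsRegularLocalRing R]
    {r : ℕ} (x : Fin r → R) (hx : ∀ j, x j ∈ maximalIdeal R)
    (hreg : IsRegularLocalRing (R ⧸ Ideal.span (Set.range x)))
    (hdim : ringKrullDim (R ⧸ Ideal.span (Set.range x)) + r = ringKrullDim R) (j : Fin r) :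
    Prime (x j) := by
  classical
  set S : Finset R := Finset.univ.image x with hSdef
  have hS : (S : Set R) = Set.range x := by
    rw [hSdef, Finset.coe_image, Finset.coe_univ, Set.image_univ]
  have sub : (S : Set R) ⊆ maximalIdeal R := by
    rw [hS]; rintro _ ⟨i, rfl⟩; exact hx i
  -- `S.card = r` by Krull's height theorem
  haveI := hreg
  obtain ⟨n, hn⟩ := exists_nat_cast_eq_ringKrullDim (R := R ⧸ Ideal.span (Set.range x))
  obtain ⟨d, hd⟩ := exists_nat_cast_eq_ringKrullDim (R := R)
  have hle : S.card ≤ r := (Finset.card_image_le).trans (by rw [Finset.card_univ, Fintype.card_fin])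
  have hKrull := ringKrullDim_le_ringKrullDim_quotient_add_card S
    (by simpa [ringJacobson_eq_maximalIdeal] using sub)
  rw [hS, hn, hd] at hKrull
  rw [hn, hd] at hdim
  have h1 : n + r = d := by exact_mod_cast hdim
  have h2 : d ≤ n + S.card := by exact_mod_cast hKrull
  have hcard : S.card = r := le_antisymm hle (by omega)
  -- Matsumura 14.2: (3) ⇒ (2)
  have h3 : IsRegularLocalRing (R ⧸ Ideal.span (S : Set R)) ∧
      ringKrullDim (R ⧸ Ideal.span (S : Set R)) + S.card = ringKrullDim R := by
    rw [hS, hcard, hn, hd]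
    exact ⟨hreg, by exact_mod_cast h1⟩
  have hli := ((quotient_isRegularLocalRing_tfae R S sub).out 2 1).mp h3
  have hxS : x j ∈ S := by rw [hSdef]; exact Finset.mem_image_of_mem x (Finset.mem_univ j)
  have hne := hli.ne_zero ⟨x j, hxS⟩
  have hx2 : x j ∉ maximalIdeal R ^ 2 := fun h2 => hne (by
    change (maximalIdeal R).toCotangent ⟨x j, sub hxS⟩ = 0
    exact (Ideal.toCotangent_eq_zero _ _).mpr h2)
  exact IsRegularLocalRing.prime_of_not_mem_sq (hx j) hx2

/-- **Kato's (2.1) from an identification of Kato's ideal.** If Kato's ideal of the chart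
`ψ : P → N` (`P ⊆ ℤⁿ`) equals `I`, `N/I` is a regular local ring, `dim N/I + k = dim N` and
`rank (span of the face of units) + k = n`, then the chart is log regular. [cite: Kato1994, Def. (2.1)] -/
theorem LogChart.isLogRegularLocal_of_eq {n : ℕ} {N : Type u} [CommRing N]
    (P : AddSubmonoid (Fin n → ℤ)) (ψ : Multiplicative P →* N) (I : Ideal N)
    (hI : LogChart.nonunitIdeal P ψ = I) (hreg : IsRegularLocalRing (N ⧸ I)) (k : ℕ)
    (hdim : ringKrullDim (N ⧸ I) + k = ringKrullDim N)
    (hrank : Module.finrank ℤ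
      (Submodule.span ℤ ((fun v : P => (v : Fin n → ℤ)) '' LogChart.unitFace P ψ)) + k = n) :
    LogChart.IsLogRegularLocal P ψ := by
  subst hI
  refine ⟨hreg, ?_⟩
  rw [← hdim]
  congr 2
  have : n - Module.finrank ℤ
      (Submodule.span ℤ ((fun v : P => (v : Fin n → ℤ)) '' LogChart.unitFace P ψ)) = k := by
    omega
  rw [this]

end Literature.AlgebraicGeometry.Resolution
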